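import Summits.RiemannHypothesis.RiemannHypothesis.Theorems.SuzukiStructureFunctionsWindowResolvent
import Summits.RiemannHypothesis.RiemannHypothesis.Theorems.SuzukiWindowsDoorWindowDilation

/-!
# SuzukiStructureFunctionsWindowNorm — the window norm is intrinsic: `‖𝖪[t]‖` on `L²(ℝ)` equals `‖A‖` for EVERY bounded
# realisation `A` on `L²(−t,t)`; hence all window norms (the column's `σ₁(θ,t) = ‖𝖪_θ[t]‖`) are continuous in `t`
# (column DBR; RH-FREE)

LINE 1 — LABEL: RH-FREE (ζ-free operator theory for ANY continuous kernel; no zeros, no positivity); bears_on LADDER-RH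
B-D → B-P(P2): the window-norm laws of the column (ET1x, `SuzukiWindowsDoor*` files state everything «for any bounded `A` with
the kernel formula on `L²(−t,t)`») now inherit continuity in `t` from `…WindowFamily`. WHAT THIS IS NOT: not progress toward
RH; no window norm is computed or bounded here.

Source: M. Suzuki, J. Funct. Anal. 281 (2021) 109116 = arXiv:1606.05726 [Suzuki2021Hamiltonians], (2.9)/§3.1; Reed–Simon I
Thm VI.23 (tree).

Contents (seat rh-dbr-eng-5 g7): `norm_winOpL2_apply_sq(')` (`‖𝖪[t]φ‖² = ∫_S(∫_S K(x+y)φ)²`), **`opNorm_winOpL2_eq`**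
(`‖winOpL2 K hK t‖ = ‖A‖` for every realisation `A` — via the tree's `sq_integral_winOp_le` / `opNorm_winOp_le_of_forall`),
**`continuousOn_opNorm_realisations`** (`t ↦ ‖A t‖` continuous on `[0,∞)` for any family of realisations).
-/

noncomputable section

-- D-0017: `Summit.<S>.<S>.…` is the designed namespace of a single-problem summit.
set_option linter.dupNamespace false

open MeasureTheory Set Filter Topology Function

namespace Summit.RiemannHypothesis.RiemannHypothesis.Theorems.SuzukiStructureFunctions

open Literature.Analysis.OperatorTheory Literature.NumberTheory.LFunctions
open Summit.RiemannHypothesis.RiemannHypothesis.Theorems.SuzukiWindowsDoorWindowDilation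
  (sq_integral_winOp_le opNorm_winOp_le_of_forall)

variable {K : ℝ → ℝ} {t : ℝ}

/-! ## §22 The window norm is intrinsic: `‖𝖪[t]‖_{L²(ℝ)} = ‖A‖` for EVERY realisation `A` of the window operator on
`L²(−t,t)`; hence the column's window norms are continuous in `t` and clean radii are open -/

/-- RH-FREE. `‖𝖪[t]φ‖² = ∫_{[−t,t]} (∫_{(−t,t)} K(x+y)φ(y) dy)² dx` for `φ ∈ L²(ℝ)`. -/
theorem norm_winOpL2_apply_sq (hK : Continuous K) (t : ℝ) (φ : Lp ℝ 2 (volume : Measure ℝ)) :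
    ‖winOpL2 K hK t φ‖ ^ 2 = ∫ x in Icc (-t) t, (∫ y in Ioo (-t) t, K (x + y) * φ y) ^ 2 := by
  have hmem := memLp_two_integral_l2Kernel_mul (memLp_winKer hK t) φ
  have heq : winOpL2 K hK t φ = hmem.toLp _ :=
    Lp.ext ((winOpL2_spec hK t φ).trans (MemLp.coeFn_toLp _).symm)
  rw [heq, norm_toLp_sq_eq_integral_norm_sq hmem]
  have e : (fun x : ℝ => ‖∫ y, winKer K t x y * φ y‖ ^ 2) =
      (Icc (-t) t).indicator (fun x => (∫ y in Ioo (-t) t, K (x + y) * φ y) ^ 2) := by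
    funext x
    by_cases hx : x ∈ Icc (-t) t
    · rw [indicator_of_mem hx, integral_winKer_mul_eq_setIntegral K hx, Real.norm_eq_abs, sq_abs]
    · rw [indicator_of_notMem hx, integral_winKer_mul_eq_zero K hx]; simp
  rw [e, integral_indicator measurableSet_Icc]

/-- RH-FREE. The same with the outer integral over the open window `(−t,t)` (endpoints are null). -/
theorem norm_winOpL2_apply_sq' (hK : Continuous K) (t : ℝ) (φ : Lp ℝ 2 (volume : Measure ℝ)) :
    ‖winOpL2 K hK t φ‖ ^ 2 = ∫ x in Ioo (-t) t, (∫ y in Ioo (-t) t, K (x + y) * φ y) ^ 2 := by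
  rw [norm_winOpL2_apply_sq, setIntegral_congr_set (Ioo_ae_eq_Icc (μ := (volume : Measure ℝ))).symm]

/-- **RH-FREE · THE WINDOW NORM IS INTRINSIC:** for every bounded realisation `A` of the window operator on `L²(−t,t)`
(a.e. kernel formula), `‖𝖪[t]‖_{L²(ℝ)→L²(ℝ)} = ‖A‖` — both norms are the supremum of the plain quadratic quantity
`∫_S(∫_S K(x+y)f)² / ∫_S f²` (the tree's `sq_integral_winOp_le` / `opNorm_winOp_le_of_forall`). -/
theorem opNorm_winOpL2_eq (hK : Continuous K)
    {A : Lp ℝ 2 (volume.restrict (Ioo (-t) t)) →L[ℝ] Lp ℝ 2 (volume.restrict (Ioo (-t) t))}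
    (hA : ∀ φ, (A φ : ℝ → ℝ) =ᵐ[volume.restrict (Ioo (-t) t)] fun x => ∫ y in Ioo (-t) t, K (x + y) * φ y) :
    ‖winOpL2 K hK t‖ = ‖A‖ := by
  apply le_antisymm
  · -- `‖𝖪[t]φ‖ ≤ ‖A‖‖φ‖`
    refine ContinuousLinearMap.opNorm_le_bound _ (norm_nonneg _) fun φ => ?_
    have hf : MemLp (φ : ℝ → ℝ) 2 (volume.restrict (Ioo (-t) t)) := (Lp.memLp φ).restrict _
    have h1 : ‖winOpL2 K hK t φ‖ ^ 2 ≤ (‖A‖ * ‖φ‖) ^ 2 := by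
      rw [norm_winOpL2_apply_sq' hK t φ, mul_pow]
      refine (sq_integral_winOp_le hA hf).trans ?_
      gcongr
      -- `∫_{(−t,t)} φ² ≤ ‖φ‖²`
      have hφ2 : ‖φ‖ ^ 2 = ∫ x, (φ : ℝ → ℝ) x ^ 2 := by
        have h := norm_toLp_sq_eq_integral_norm_sq (Lp.memLp φ)
        rw [Lp.toLp_coeFn φ (Lp.memLp φ)] at h
        rw [h]
        refine integral_congr_ae (Eventually.of_forall fun x => ?_)
        simp only [Real.norm_eq_abs, sq_abs]
      rw [hφ2]
      exact setIntegral_le_integral ((Lp.memLp φ).integrable_sq) (Eventually.of_forall fun x => sq_nonneg _)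
    exact (pow_le_pow_iff_left₀ (norm_nonneg _) (by positivity) two_ne_zero).mp h1
  · -- `‖A‖ ≤ ‖𝖪[t]‖` by the converse characterisation, testing with extensions by zero
    refine opNorm_winOp_le_of_forall hA (norm_nonneg _) fun f hf => ?_
    have hfI : MemLp ((Ioo (-t) t).indicator f) 2 (volume : Measure ℝ) :=
      (memLp_indicator_iff_restrict measurableSet_Ioo).2 hf
    set ψ : Lp ℝ 2 (volume : Measure ℝ) := hfI.toLp _ with hψ
    have hψ_ae : (ψ : ℝ → ℝ) =ᵐ[volume] (Ioo (-t) t).indicator f := MemLp.coeFn_toLp _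
    -- `‖ψ‖² = ∫_S f²`
    have hψn : ‖ψ‖ ^ 2 = ∫ x in Ioo (-t) t, f x ^ 2 := by
      rw [hψ, norm_toLp_sq_eq_integral_norm_sq hfI]
      have e : (fun x : ℝ => ‖(Ioo (-t) t).indicator f x‖ ^ 2) = (Ioo (-t) t).indicator (fun x => f x ^ 2) := by
        funext x
        by_cases hx : x ∈ Ioo (-t) t
        · rw [indicator_of_mem hx, indicator_of_mem hx, Real.norm_eq_abs, sq_abs]
        · rw [indicator_of_notMem hx, indicator_of_notMem hx]; simp
      rw [e, integral_indicator measurableSet_Ioo]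
    -- `‖𝖪[t]ψ‖² = ∫_S (∫_S K f)²`
    have hWψ : ‖winOpL2 K hK t ψ‖ ^ 2 = ∫ x in Ioo (-t) t, (∫ y in Ioo (-t) t, K (x + y) * f y) ^ 2 := by
      rw [norm_winOpL2_apply_sq' hK t ψ]
      refine setIntegral_congr_fun measurableSet_Ioo fun x _ => ?_
      congr 1
      refine integral_congr_ae ?_
      filter_upwards [ae_restrict_of_ae (s := Ioo (-t) t) hψ_ae, ae_restrict_mem measurableSet_Ioo] with y hy hyI
      rw [hy, indicator_of_mem hyI]
    calc ∫ x in Ioo (-t) t, (∫ y in Ioo (-t) t, K (x + y) * f y) ^ 2 = ‖winOpL2 K hK t ψ‖ ^ 2 := hWψ.symm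
      _ ≤ (‖winOpL2 K hK t‖ * ‖ψ‖) ^ 2 :=
          pow_le_pow_left₀ (norm_nonneg _) ((winOpL2 K hK t).le_opNorm ψ) 2
      _ = ‖winOpL2 K hK t‖ ^ 2 * ∫ x in Ioo (-t) t, f x ^ 2 := by rw [mul_pow, hψn]

/-- **RH-FREE · WINDOW NORMS ARE CONTINUOUS IN `t` FOR ANY REALISATIONS:** for any family `A t` of bounded realisations of
the window operators on `L²(−t,t)` (`t ≥ 0`), `t ↦ ‖A t‖` is continuous on `[0,∞)` — e.g. the column's
`t ↦ σ₁(θ,t) = ‖𝖪_θ[t]‖`. -/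
theorem continuousOn_opNorm_realisations (hK : Continuous K)
    {A : (t : ℝ) → (Lp ℝ 2 (volume.restrict (Ioo (-t) t)) →L[ℝ] Lp ℝ 2 (volume.restrict (Ioo (-t) t)))}
    (hA : ∀ t : ℝ, 0 ≤ t → ∀ φ, ((A t) φ : ℝ → ℝ) =ᵐ[volume.restrict (Ioo (-t) t)]
      fun x => ∫ y in Ioo (-t) t, K (x + y) * φ y) :
    ContinuousOn (fun t : ℝ => ‖A t‖) (Ici 0) :=
  (continuousOn_norm_winOpL2 hK).congr fun t ht => (opNorm_winOpL2_eq hK (hA t ht)).symm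

end Summit.RiemannHypothesis.RiemannHypothesis.Theorems.SuzukiStructureFunctions

end
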